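import Literature.NumberTheory.EllipticCurves.Kato2004.IwasawaCohomologyZetaLiftTwo
import Literature.NumberTheory.EllipticCurves.Kato2004.IwasawaH2DescentFiniteSelmer
import Literature.NumberTheory.EllipticCurves.Kato2004.MainConjectureDescentSkeletonProofs
import Literature.NumberTheory.EllipticCurves.BSDSelmerCMPConverseKatoDescentProofs
import Literature.NumberTheory.EllipticCurves.TateModuleFreeProofs
import Literature.NumberTheory.EllipticCurves.Rank1Residual.Predicates
import Summits.BirchSwinnertonDyer.BirchSwinnertonDyer.Theorems.CongruentShaFreeCutKatoDescentRealisable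
import HarnessLib

/-!
# Route `TwoAdicConverse` — Theses-free CARRIER of the Kato–zeta road at `p = 2`: Kato's Main Conjecture
# 12.10 READ AT THE PRIME `(T)` for the PINNED ZETA LIFT of `T₂E` (`KatoMainConjectureAtTAtTwo W`), its
# ∀-closures, and the rank-`0` `2`-converse from it (Burungale–Tian Thm. 3.1 / Remark 3.2) — every other input
# a NAMED fact or a displayed READING on pinned objects

Cell `bsd-2adic`, prover seat `bsd-2adic-conv-2` (GEN 10), items stmt-BirchSwinnertonDyer-19219
(`MultiplicativeRankZeroTwoConverse`) / -19218 (`GoodOrdinaryRankZeroTwoConverse`) of route `TwoAdicConverse`.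
This is the carrier the planner asked for (bsd-2adic-plan g13, INBOX 04:28:39Z / TARGET RC-31: «the crux object
as ONE ∀-closed Prop in a THESES-FREE module … binder shape `∀ W [IsElliptic] [IsGloballyMinimal], ¬ W.HasCM →
<Kato 12.10 ⊗ ℚ₂ at (T) for W>`»), made HONESTLY typable tonight by the `p = 2` zeta lift
(`Kato2004/IwasawaCohomologyZetaLiftTwo.lean`, this seat, p477902): WITHOUT a pinned zeta element every faithful
`z`-free object on the v2 pin is the converse itself (`Theorems/TwoAdicConverseKatoZetaPinned.lean`, binder
(VAN-K)); WITH it, the research object is an Iwasawa-theoretic statement about PINNED objects.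

## The object (§1)

`KatoMainConjectureAtTAtTwo W` — for every cyclotomic `ℤ₂`-extension datum `(κ, γ)`, every pinned
`I : IwasawaH1Data W 2 κ γ` (`𝐇¹_Γ(T₂W)`, bsd-smallim) and descent package `J : IwasawaH2Data W 2 κ γ I`
(`𝐇²_Γ(T₂W)` with (14.14.1), bsd-cn100-ty), every `ZetaBody W 2 f ι κ' Λ' c d a A z x` witness for a newform `f`
of `W` (Kato's Euler system for `T₂W` with its values, `Kato2004.EulerSystemValues`) and ITS lift `𝐲 ∈ 𝐇¹_Γ`
(`proj n 𝐲 = Cor_{ℚ(μ_{2^{n+2}})/ℚ_n}(z_{n+2,∅})`, unique by `IwasawaH1Data.existsUnique_lift_of_zetaBody_two`):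
IF `𝐇¹_Γ/Λ𝐲` is torsion [Kato Thm. 12.4 (2) + 12.5 (2): `𝐇¹ ⊗ ℚ` free of rank one, `𝐇¹/Z` torsion; i.e.
`𝐲 ≠ 0`, which rests on Rohrlich's non-vanishing — an antecedent, so a zero witness makes the clause vacuous,
never false] THEN `length_{Λ_(T)} (𝐇¹_Γ/Λ𝐲)_(T) = length_{Λ_(T)} (𝐇²_Γ)_(T)` — Kato's Conj. 12.10 («`𝐇²(T)`
and `𝐇¹(T)/Z(f,T)` have the same characteristic ideal in `Λ ⊗ ℚ`», p. 224) READ AT THE SINGLE height-one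
prime `𝔮 = (T)`. WHY `(T)`-LOCAL and not the ideal equality: (i) it is EXACTLY what Burungale–Tian's deduction
consumes (their proof localises at `𝔮`, p. 6; tree: `…_of_lengthAt_primeT_eq`); (ii) it is ROBUST under the
`(c,d)`-modification of Kato's elements — the tree's `ZetaBody` classes are Kato's `_{c,d}z`, which differ from
`z_γ` by `μ_{c,d} = (c² − c^{k}σ_c)(…)` (Kato §13.9); at `p = 2`, `c` odd forces `8 ∣ c² − 1`, so `μ_{c,d}` is
NEVER a unit of `Λ` and the global «`∃ a b, 2^a·char 𝐇² = 2^b·char(𝐇¹/Λ𝐲)`» form could FAIL for the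
`(c,d)`-lift even when 12.10 holds, while `μ_{c,d}(0) = (c²−1)(…) ≠ 0` makes `μ_{c,d}` a unit AT `(T)`.
STATUS: OPEN for non-CM `f` at `p = 2` (Burungale–Tian, Ann. of Math. 203 (2026) p. 3: «we plan to consider
instances of Kato's main conjecture for 2-ordinary non-CM curves»); Kato Thm. 12.5 (3) gives `≤` up to the
`𝐇²_loc` term, which at a MULTIPLICATIVE `2` IS present at `𝔮 = (T)` ((12.5.1): weight `2`, `f` not potentially
good at `2`, `χ = 1`) — the exceptional-zero phenomenon lives in Kato's THEOREM, not in the conjecture. As a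
∀-`W` statement this object is STRONGER than the rank-`0` converse (on a rank-one curve `length_(T) 𝐇² = 0` by
the accepted `finite_descentCokernel_of_rankOne`, and the clause says `proj₀ 𝐲` is non-torsion — Kato's class is
non-zero, a Kolyvagin/Perrin-Riou-type statement); restricted to the finite-`Sel` locus it is the converse
(GEN 0's circularity principle). ∀-closures: `KatoMainConjectureAtTAtTwoNonCM` (every non-CM `W`, the planner's
shared crux) and `KatoMainConjectureAtTAtTwoOnLeaf` (non-CM, good ordinary OR multiplicative at `2` = the leaf's scope).

## The deduction (§2–§3; THEOREMS)

§2 (per `W`, given pinned data): (3.1) `Sel_{2^∞}` finite ⟹ `𝐇²_Γ/T` finite [fact `Kato2004.finite_descentCokernel_of_finite_selmer`]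
⟹ `length_(T) 𝐇² = 0` (Lemma 14.15) ⟹ by the object `length_(T)(𝐇¹/Λ𝐲) = 0` ⟹ `2^m 𝐲 ∉ T𝐇¹` (generator lemma) ⟹
`2^m • proj₀ 𝐲 ≠ 0` ((14.14.1)) ⟹ with the VANISHING READING for the lift (VAN-𝐲: `Sel_{2^∞}` finite ∧ `L(E,1) = 0 ⟹
proj₀ 𝐲` torsion — Kato Thm. 12.5 (1) `exp*(loc₂ proj₀ 𝐲) = (Euler factor ≠ 0)·L(E,1)/Ω·ω`, `H¹(ℚ_ℓ, V) = 0` (`ℓ ≠ 2`),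
`H¹_f(ℚ, V) = Sel ⊗ ℚ = 0`; Burungale–Tian (3.3); a DISPLAYED binder, Literature-fact material) `L(E,1) ≠ 0`. §3 the
∀-closed statements with UNFOLDED conclusions (no `Theses` import here; the by-name bridges are one `unfold; exact` each in
a `Theses` leaf): displayed = CONSTRUCTION facts {`nonempty_iwasawaH1Data`, `nonempty_iwasawaH2Data`, `thm12_4`} + PRINT
fact {`finite_descentCokernel_of_finite_selmer`} + READINGS {(R-𝐳) a `ZetaBody` witness exists [facts
`exists_eulerSystem_expStar_values` / `exists_member_…` + isogeny invariance], (NZ) its lift is non-zero [Thm. 12.5 (2),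
Rohrlich], (VAN-𝐲)} + the ONE research object. No `p`-adic `L`-function, no A235/A236, no Spieß/GS, no period, no K11, no
split/non-split or ordinary/supersingular distinction, no `E[2]` hypothesis.

HONEST FRAMING: `@[conjecture]` definitions (nothing asserted) + theorems; no named fact minted; BSD is not advanced;
a closed 19218/19219 would close a rung leaf, never the summit. PARTITION: none — RANK axis (S3); companion X5@2 (B1·O1).

References: [Kato2004Asterisque] Thm. 12.4–12.5, Conj. 12.10, §13, (14.9.3), §14.14, Lemma 14.15; [BurungaleTian2026]
Thm. 3.1 (proof (3.1)–(3.3), p. 6), Remark 3.2, §1.0.3; tree: `Kato2004/IwasawaCohomology{,ZetaLiftTwo}.lean`,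
`Kato2004/IwasawaH2Descent{,FiniteSelmer}.lean`, `Kato2004/EulerSystemValues.lean`, `Theorems/TwoAdicConverseKatoZetaPinned.lean`.
-/

set_option autoImplicit false
set_option linter.dupNamespace false

noncomputable section

open scoped Classical NumberField TensorProduct
open WeierstrassCurve Field IsDedekindDomain Literature.NumberTheory.EllipticCurves
  Literature.NumberTheory.EllipticCurves.ModularForms
  Literature.NumberTheory.EllipticCurves.Kato2004 Literature.NumberTheory.EllipticCurves.IwasawaAlgebra
  Literature.NumberTheory.EllipticCurves.Kato2004.EulerSystemValues
  Literature.NumberTheory.GaloisRepresentations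
  Literature.NumberTheory.EllipticCurves.Rank1Residual
  Summit.BirchSwinnertonDyer.BirchSwinnertonDyer.Theorems.CongruentShaFreeCutKatoDescentRealisable

namespace Summit.BirchSwinnertonDyer.BirchSwinnertonDyer.Theorems.TwoAdicKatoZeta

/-! ## §1 The object: Kato's Conj. 12.10 read at `(T)` for the pinned zeta lift of `T₂W` -/

/-- **Kato's Main Conjecture 12.10 for `T₂W`, READ AT THE PRIME `(T)`, ON PINNED OBJECTS (`p = 2`).** For every
cyclotomic `ℤ₂`-extension datum `κ` with topological generator `γ`, every pinned Iwasawa cohomology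
`I : IwasawaH1Data W 2 κ γ` (`𝐇¹_Γ(T₂W)`), every descent package `J : IwasawaH2Data W 2 κ γ I` (`𝐇²_Γ(T₂W)`), every
newform `f` of `W` with a `ZetaBody W 2 f ι κ' Λ' c d a A z x` witness (Kato's Euler system `_{c,d}z` for `T₂W` with
its values) and every `𝐲 ∈ 𝐇¹_Γ` lifting its `2`-power levels (`proj n 𝐲 = Cor_{ℚ(μ_{2^{n+2}})/ℚ_n}(z_{n+2,∅})`; such
a `𝐲` exists and is unique, `IwasawaH1Data.existsUnique_lift_of_zetaBody_two`): IF `𝐇¹_Γ/Λ𝐲` is a torsion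
`Λ`-module (Kato Thm. 12.4 (2) + 12.5 (2); an antecedent — a degenerate witness makes the clause vacuous) THEN
`length_{Λ_(T)}((𝐇¹_Γ/Λ𝐲)_(T)) = length_{Λ_(T)}((𝐇²_Γ)_(T))` — «`𝐇²(T)` and `𝐇¹(T)/Z(f,T)` have the same
characteristic ideal» (Conj. 12.10, in `Λ ⊗ ℚ`) at the one height-one prime `𝔮 = (T)` that the rank-`0`
`2`-converse consumes (Burungale–Tian Thm. 3.1 / Remark 3.2); robust under the `(c,d)`-modification
(`μ_{c,d}(0) ≠ 0`). The `ℤ₂`-structure facts on `T₂W` (continuity, freeness, finiteness) are the tree's theorems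
`TateModule.continuousSMul_padicInt`, `module_free_tateModule_holds`, `module_finite_tateModule_holds`. OPEN for
non-CM `f` at `p = 2`; Kato Thm. 12.5 (3) is the inequality `≤` up to `𝐇²_loc`, non-zero at `(T)` exactly at a
multiplicative `2` ((12.5.1)). A TARGET; nothing asserted.
[cite: Kato2004Asterisque, Conj. 12.10 (p. 224), Thm. 12.4 (2) (p. 221), Thm. 12.5 (2)(3) (p. 222), §13.1 (pp. 224–225)]
[cite: BurungaleTian2026, Thm. 3.1 (proof, p. 6), Remark 3.2 and §1.0.3 (p. 3)] -/
@[conjecture] def KatoMainConjectureAtTAtTwo (W : WeierstrassCurve ℚ) [W.IsElliptic] : Prop :=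
  letI : ContinuousSMul ℤ_[2] (W.tateModule 2) := TateModule.continuousSMul_padicInt
  haveI : Module.Free ℤ_[2] (W.tateModule 2) := W.module_free_tateModule_holds 2
  haveI : Module.Finite ℤ_[2] (W.tateModule 2) := W.module_finite_tateModule_holds 2
  ∀ (κ : ZpExtension ℚ 2) (γ : absoluteGaloisGroup ℚ) (hκ : κ.IsCyclotomic), κ.IsTopGenerator γ →
    ∀ (I : IwasawaH1Data W 2 κ γ) (J : IwasawaH2Data W 2 κ γ I)
      ⦃N : ℕ⦄ [NeZero N] (f : CuspForm (CongruenceSubgroup.Gamma0 N) 2), IsNewformOf W f →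
    ∀ (ι : (m : ℕ) → (CyclotomicField m ℚ →+* ℂ)) (κ' : ℝ)
      (Λ' : ∀ (k : ℕ) (r : Finset (HeightOneSpectrum (𝓞 ℚ))),
        H1 (tateRep W 2) (cycSubgroup 2 k r) →ₗ[ℤ_[2]] ℚ_[2] ⊗[ℚ] CyclotomicField (cycLevel 2 k r) ℚ)
      (c d a : ℤ) (A : ℕ)
      (z : ∀ (k : ℕ) (r : (cyclotomicLevelsRat 2 (badPlaces c d A N)).Ideals),
        H1 (tateRep W 2) ((cyclotomicLevelsRat 2 (badPlaces c d A N)).level k r.1))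
      (x : ∀ (k : ℕ) (r : (cyclotomicLevelsRat 2 (badPlaces c d A N)).Ideals),
        CyclotomicField (cycLevel 2 k r.1) ℚ),
      ZetaBody W 2 f ι κ' Λ' c d a A z x →
    ∀ y : I.H, (∀ n : ℕ, I.proj n y = levelToLayerTwo W hκ (badPlaces c d A N) n
        (z (n + 2) (cyclotomicLevelsRat 2 (badPlaces c d A N)).idealOne)) →
      Module.IsTorsion (IwasawaAlgebra 2) (I.H ⧸ (IwasawaAlgebra 2) ∙ y) →
        Module.lengthAt (IwasawaAlgebra 2) (I.H ⧸ (IwasawaAlgebra 2) ∙ y) (primeT 2) =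
          Module.lengthAt (IwasawaAlgebra 2) J.H2 (primeT 2)

/-- **The ∀-closed object for the planner's shared crux (reduction-type-free):** Kato's Conj. 12.10 at `(T)` for
the pinned zeta lift of `T₂E`, for EVERY non-CM `E/ℚ` (globally minimal `W`). Both rank-`0` cruxes of route S3
(19218 good ordinary, 19219 multiplicative) — and the supersingular / additive cases, which are no items — follow
from it and four named facts + two readings (`nonCM_rankZero_twoConverse_of_katoMainConjectureAtT`). STRONGER than
the leaf needs on two counts (every reduction type; rank-one content on infinite-`Sel` curves), recorded for T1.
A TARGET; nothing asserted. [cite: Kato2004Asterisque, Conj. 12.10 (p. 224)] [cite: BurungaleTian2026, Remark 3.2 and §1.0.3 (p. 3)] -/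
@[conjecture] def KatoMainConjectureAtTAtTwoNonCM : Prop :=
  ∀ (W : WeierstrassCurve ℚ) [W.IsElliptic] [W.IsGloballyMinimal], ¬ W.HasCM → KatoMainConjectureAtTAtTwo W

/-- **The same on the leaf's own scope** (non-CM, good ordinary OR multiplicative at `2` — the union of the
habitats of 19218 and 19219); implied by `KatoMainConjectureAtTAtTwoNonCM`
(`katoMainConjectureAtTAtTwoOnLeaf_of_nonCM`). A TARGET; nothing asserted.
[cite: Kato2004Asterisque, Conj. 12.10 (p. 224)] [cite: BurungaleTian2026, Remark 3.2] -/
@[conjecture] def KatoMainConjectureAtTAtTwoOnLeaf : Prop :=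
  ∀ (W : WeierstrassCurve ℚ) [W.IsElliptic] [W.IsGloballyMinimal], ¬ W.HasCM →
    (GoodOrd W 2 ∨ Mult W 2) → KatoMainConjectureAtTAtTwo W

/-- The reduction-type-free object implies the leaf-scoped one. [folklore] -/
theorem katoMainConjectureAtTAtTwoOnLeaf_of_nonCM (h : KatoMainConjectureAtTAtTwoNonCM) :
    KatoMainConjectureAtTAtTwoOnLeaf := fun W _ _ hcm _ => h W hcm

/-! ## §2 Burungale–Tian Thm. 3.1 on the pinned zeta lift (per `W`, given pinned data) -/

section PerCurve
variable (W : WeierstrassCurve ℚ) [W.IsElliptic] [ContinuousSMul ℤ_[2] (W.tateModule 2)]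
  {κ : ZpExtension ℚ 2} {γ : absoluteGaloisGroup ℚ}

/-- **The `Λ`-module step on the pinned pair** (Burungale–Tian (3.1)–(3.2) and the sentence after (3.2), with
Kato's Lemma 14.15): for `I : IwasawaH1Data W 2 κ γ` with `𝐇¹_Γ` finitely generated and torsion free, a descent
package `J`, and `y ∈ 𝐇¹_Γ`, `y ≠ 0`: if `length_(T)(𝐇¹_Γ/Λy) = length_(T)(𝐇²_Γ)` and `𝐇²_Γ/T·𝐇²_Γ` is finite, then
`2^m • proj₀ y ≠ 0` in `H¹(ℚ, T₂W)` for every `m` (`length_(T) 𝐇² = 0` by Lemma 14.15; the generator lemma puts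
`2^m y` outside `T𝐇¹`; (14.14.1) `proj₀ x = 0 ↔ x ∈ T𝐇¹`).
[cite: BurungaleTian2026, Thm. 3.1 (proof, p. 6)] [cite: Kato2004Asterisque, Lemma 14.15 (p. 244) and §14.14 (14.14.1) (p. 243)] -/
theorem forall_pow_smul_proj_zero_ne_zero_of_lengthAt_eq (I : IwasawaH1Data W 2 κ γ)
    [Module.Finite (IwasawaAlgebra 2) I.H] [NoZeroSMulDivisors (IwasawaAlgebra 2) I.H]
    (J : IwasawaH2Data W 2 κ γ I) {y : I.H} (hy : y ≠ 0)
    (hT : Module.lengthAt (IwasawaAlgebra 2) (I.H ⧸ (IwasawaAlgebra 2) ∙ y) (primeT 2) =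
      Module.lengthAt (IwasawaAlgebra 2) J.H2 (primeT 2))
    (hfin : Finite (coinvariants 2 J.H2)) : ∀ m : ℕ, 2 ^ m • I.proj 0 y ≠ 0 := by
  haveI := J.finite_H2
  have h0 : Module.lengthAt (IwasawaAlgebra 2) (I.H ⧸ (IwasawaAlgebra 2) ∙ y) (primeT 2) = 0 := by
    rw [hT]
    exact Kato2004.lengthAt_primeT_eq_zero_of_finite_coinvariants J.H2 J.isTorsion_H2 hfin
  have hG : ∃ g ∈ ({y} : Set I.H), g ≠ 0 := ⟨y, Set.mem_singleton _, hy⟩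
  obtain ⟨g, hg, h⟩ :=
    IwasawaAlgebra.exists_forall_pow_smul_notMem_TSubmodule_of_lengthAt_eq_zero 2 hG h0
  rw [Set.mem_singleton_iff] at hg
  subst hg
  intro m hm
  refine h m ?_
  rw [← J.proj_zero_eq_zero_iff_mem_TSubmodule, ← map_natCast (PowerSeries.C (R := ℤ_[2])) 2, ← map_pow,
    I.proj_C_smul, ← Nat.cast_pow, Nat.cast_smul_eq_nsmul]
  exact hm

/-- **`L(E,1) ≠ 0` from a finite `Sel_{2^∞}(E/ℚ)`, on the pinned zeta lift** (Burungale–Tian Thm. 3.1 / Remark 3.2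
for `f = f_E` at `p = 2`). Given pinned data `(κ, γ, I, J)`, a `ZetaBody` witness for a newform `f` of `W` and its
lift `𝐲 ≠ 0`: (3.1) `hcok` (on the pinned descent cokernel), the vanishing reading (VAN-𝐲) `hvan` [Kato Thm. 12.5 (1)
+ `H¹(ℚ_ℓ,V) = 0` + `H¹_f(ℚ,V) = 0`], and the object `KatoMainConjectureAtTAtTwo W` give `Sel_{2^∞}` finite ⟹
`L(E,1) ≠ 0`. [cite: BurungaleTian2026, Thm. 3.1 (proof, (3.1)–(3.3), p. 6) and Remark 3.2]
[cite: Kato2004Asterisque, Thm. 12.5 (1) (p. 222), Conj. 12.10 (p. 224), §14.14 (p. 243)] -/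
theorem entireLFunction_one_ne_zero_of_katoMainConjectureAtT
    [Module.Free ℤ_[2] (W.tateModule 2)] [Module.Finite ℤ_[2] (W.tateModule 2)]
    (hκ : κ.IsCyclotomic) (hγ : κ.IsTopGenerator γ) (I : IwasawaH1Data W 2 κ γ)
    (hIf : Module.Finite (IwasawaAlgebra 2) I.H) (hIt : Module.IsTorsionFree (IwasawaAlgebra 2) I.H)
    (hIr : Module.rank (IwasawaAlgebra 2) I.H = 1) (J : IwasawaH2Data W 2 κ γ I)
    {N : ℕ} [NeZero N] (f : CuspForm (CongruenceSubgroup.Gamma0 N) 2) (hf : IsNewformOf W f)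
    (ι : (m : ℕ) → (CyclotomicField m ℚ →+* ℂ)) (κ' : ℝ)
    (Λ' : ∀ (k : ℕ) (r : Finset (HeightOneSpectrum (𝓞 ℚ))),
      H1 (tateRep W 2) (cycSubgroup 2 k r) →ₗ[ℤ_[2]] ℚ_[2] ⊗[ℚ] CyclotomicField (cycLevel 2 k r) ℚ)
    (c d a : ℤ) (A : ℕ)
    (z : ∀ (k : ℕ) (r : (cyclotomicLevelsRat 2 (badPlaces c d A N)).Ideals),
      H1 (tateRep W 2) ((cyclotomicLevelsRat 2 (badPlaces c d A N)).level k r.1))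
    (x : ∀ (k : ℕ) (r : (cyclotomicLevelsRat 2 (badPlaces c d A N)).Ideals),
      CyclotomicField (cycLevel 2 k r.1) ℚ)
    (hbody : ZetaBody W 2 f ι κ' Λ' c d a A z x) (y : I.H)
    (hylift : ∀ n : ℕ, I.proj n y = levelToLayerTwo W hκ (badPlaces c d A N) n
      (z (n + 2) (cyclotomicLevelsRat 2 (badPlaces c d A N)).idealOne))
    (hy : y ≠ 0)
    (hcok : Finite (W.selmerGroupPInfty 2) → Finite (IwasawaH1Data.descentCokernel I))
    (hvan : Finite (W.selmerGroupPInfty 2) → W.entireLFunction 1 = 0 → ∃ n : ℕ, 2 ^ n • I.proj 0 y = 0)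
    (hMC : KatoMainConjectureAtTAtTwo W) (hfin : Finite (W.selmerGroupPInfty 2)) :
    W.entireLFunction 1 ≠ 0 := by
  intro hL
  obtain ⟨n, hn⟩ := hvan hfin hL
  haveI := hIf
  haveI := hIt
  haveI : NoZeroSMulDivisors (IwasawaAlgebra 2) I.H := noZeroSMulDivisors_of_isTorsionFree I.H
  have hfr : Module.finrank (IwasawaAlgebra 2) I.H = 1 := Module.finrank_eq_of_rank_eq (by rw [hIr]; rfl)
  have htor : Module.IsTorsion (IwasawaAlgebra 2) (I.H ⧸ (IwasawaAlgebra 2) ∙ y) :=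
    IwasawaAlgebra.isTorsion_quotient_span_singleton_of_finrank_eq_one 2 hfr hy
  -- the object, unfolded; its `letI`/`haveI` instances on `T₂W` are `Prop`-valued, so they agree with the
  -- section's instance binders by proof irrelevance
  have hMC' := hMC
  unfold KatoMainConjectureAtTAtTwo at hMC'
  have hT := hMC' κ γ hκ hγ I J f hf ι κ' Λ' c d a A z x hbody y hylift htor
  exact forall_pow_smul_proj_zero_ne_zero_of_lengthAt_eq W I J hy hT
    (J.finite_descentCokernel_iff_finite_coinvariants_H2.mp (hcok hfin)) n hn

/-- **The rank-`0` `2`-converse at `W` on the pinned zeta lift**: same data and readings as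
`entireLFunction_one_ne_zero_of_katoMainConjectureAtT`; `corank_{ℤ₂} Sel_{2^∞}(E/ℚ) = 0 ⟹ ord_{s=1} L(E,s) = 0`
(`Finite Sel ↔ selmerCorank = 0`; `r_an = 0` from `L(E,1) ≠ 0` needs no continuation).
[cite: BurungaleTian2026, Thm. 1.1, Thm. 3.1 and Remark 3.2] -/
theorem analyticRank_eq_zero_of_katoMainConjectureAtT
    [Module.Free ℤ_[2] (W.tateModule 2)] [Module.Finite ℤ_[2] (W.tateModule 2)]
    (hκ : κ.IsCyclotomic) (hγ : κ.IsTopGenerator γ) (I : IwasawaH1Data W 2 κ γ)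
    (hIf : Module.Finite (IwasawaAlgebra 2) I.H) (hIt : Module.IsTorsionFree (IwasawaAlgebra 2) I.H)
    (hIr : Module.rank (IwasawaAlgebra 2) I.H = 1) (J : IwasawaH2Data W 2 κ γ I)
    {N : ℕ} [NeZero N] (f : CuspForm (CongruenceSubgroup.Gamma0 N) 2) (hf : IsNewformOf W f)
    (ι : (m : ℕ) → (CyclotomicField m ℚ →+* ℂ)) (κ' : ℝ)
    (Λ' : ∀ (k : ℕ) (r : Finset (HeightOneSpectrum (𝓞 ℚ))),
      H1 (tateRep W 2) (cycSubgroup 2 k r) →ₗ[ℤ_[2]] ℚ_[2] ⊗[ℚ] CyclotomicField (cycLevel 2 k r) ℚ)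
    (c d a : ℤ) (A : ℕ)
    (z : ∀ (k : ℕ) (r : (cyclotomicLevelsRat 2 (badPlaces c d A N)).Ideals),
      H1 (tateRep W 2) ((cyclotomicLevelsRat 2 (badPlaces c d A N)).level k r.1))
    (x : ∀ (k : ℕ) (r : (cyclotomicLevelsRat 2 (badPlaces c d A N)).Ideals),
      CyclotomicField (cycLevel 2 k r.1) ℚ)
    (hbody : ZetaBody W 2 f ι κ' Λ' c d a A z x) (y : I.H)
    (hylift : ∀ n : ℕ, I.proj n y = levelToLayerTwo W hκ (badPlaces c d A N) n
      (z (n + 2) (cyclotomicLevelsRat 2 (badPlaces c d A N)).idealOne))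
    (hy : y ≠ 0)
    (hcok : Finite (W.selmerGroupPInfty 2) → Finite (IwasawaH1Data.descentCokernel I))
    (hvan : Finite (W.selmerGroupPInfty 2) → W.entireLFunction 1 = 0 → ∃ n : ℕ, 2 ^ n • I.proj 0 y = 0)
    (hMC : KatoMainConjectureAtTAtTwo W) (h0 : W.selmerCorank 2 = 0) : W.analyticRank = 0 :=
  analyticRank_eq_zero_of_entireLFunction_one_ne_zero W
    (entireLFunction_one_ne_zero_of_katoMainConjectureAtT W hκ hγ I hIf hIt hIr J f hf ι κ' Λ' c d a A z x
      hbody y hylift hy hcok hvan hMC ((finite_selmerGroupPInfty_iff_selmerCorank_eq_zero W 2).2 h0))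

end PerCurve

/-! ## §3 The ∀-closed deduction (conclusions UNFOLDED — this module imports no `Theses` file) -/

section Route
/-- **The rank-`0` `2`-converse for EVERY non-CM `E/ℚ` from the ONE research object `KatoMainConjectureAtTAtTwoNonCM`,
four NAMED facts and two READINGS.** Named facts: `nonempty_iwasawaH1Data` [(12.2.1)], `nonempty_iwasawaH2Data`
[Thm. 12.4 (1), (14.14.1)], `thm12_4` [Thm. 12.4 (2)], `finite_descentCokernel_of_finite_selmer` [(14.9.3) +
(14.14.1)–(14.14.2) in the finite-`Sel` case; Burungale–Tian (3.1)]. Readings (displayed; Literature-fact material for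
the Kato2004 typer lane): (R-𝐳) `hbody` — for every non-CM `W` a `ZetaBody` witness for a newform of `W` exists at
`p = 2` [facts `exists_eulerSystem_expStar_values` (under `Irr(W[2])`) / `exists_member_eulerSystem_expStar_values`
(at Kato's member) + isogeny invariance of the converse]; (NZ ∧ VAN-𝐲) `hread` — its lift `𝐲` is non-zero [Thm.
12.5 (2), Rohrlich] and `Sel_{2^∞}` finite ∧ `L(E,1) = 0 ⟹ proj₀ 𝐲` torsion [Thm. 12.5 (1) + `H¹(ℚ_ℓ,V) = 0` +
`H¹_f(ℚ,V) = 0`; Burungale–Tian (3.3)]. Conclusion (UNFOLDED; the by-name bridges to `MultiplicativeRankZeroTwoConverse`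
/ `GoodOrdinaryRankZeroTwoConverse` are one `unfold; exact` each in a `Theses` leaf): for every non-CM `E/ℚ`,
whatever its reduction at `2`, `corank_{ℤ₂} Sel_{2^∞}(E/ℚ) = 0 ⟹ ord_{s=1} L(E,s) = 0`. Nothing asserted; credits
nothing. [cite: BurungaleTian2026, Thm. 3.1, Remark 3.2 and §1.0.3 (p. 3)]
[cite: Kato2004Asterisque, Thm. 12.4 (p. 221), Thm. 12.5 (1)(2) (pp. 221–222), Conj. 12.10 (p. 224), (14.9.3) (p. 240), §14.14 (p. 243)] -/
theorem nonCM_rankZero_twoConverse_of_katoMainConjectureAtT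
    (h1 : nonempty_iwasawaH1Data) (h2 : nonempty_iwasawaH2Data) (h12 : thm12_4)
    (h31 : finite_descentCokernel_of_finite_selmer)
    (hbody : ∀ (W : WeierstrassCurve ℚ) [W.IsElliptic] [W.IsGloballyMinimal], ¬ W.HasCM →
      letI : ContinuousSMul ℤ_[2] (W.tateModule 2) := TateModule.continuousSMul_padicInt
      haveI : Module.Free ℤ_[2] (W.tateModule 2) := W.module_free_tateModule_holds 2
      haveI : Module.Finite ℤ_[2] (W.tateModule 2) := W.module_finite_tateModule_holds 2
      ∃ (N : ℕ) (_ : NeZero N) (f : CuspForm (CongruenceSubgroup.Gamma0 N) 2) (_ : IsNewformOf W f)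
        (ι : (m : ℕ) → (CyclotomicField m ℚ →+* ℂ)) (κ' : ℝ)
        (Λ' : ∀ (k : ℕ) (r : Finset (HeightOneSpectrum (𝓞 ℚ))),
          H1 (tateRep W 2) (cycSubgroup 2 k r) →ₗ[ℤ_[2]] ℚ_[2] ⊗[ℚ] CyclotomicField (cycLevel 2 k r) ℚ)
        (c d a : ℤ) (A : ℕ)
        (z : ∀ (k : ℕ) (r : (cyclotomicLevelsRat 2 (badPlaces c d A N)).Ideals),
          H1 (tateRep W 2) ((cyclotomicLevelsRat 2 (badPlaces c d A N)).level k r.1))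
        (x : ∀ (k : ℕ) (r : (cyclotomicLevelsRat 2 (badPlaces c d A N)).Ideals),
          CyclotomicField (cycLevel 2 k r.1) ℚ),
        ZetaBody W 2 f ι κ' Λ' c d a A z x)
    (hread : ∀ (W : WeierstrassCurve ℚ) [W.IsElliptic] [W.IsGloballyMinimal], ¬ W.HasCM →
      letI : ContinuousSMul ℤ_[2] (W.tateModule 2) := TateModule.continuousSMul_padicInt
      haveI : Module.Free ℤ_[2] (W.tateModule 2) := W.module_free_tateModule_holds 2
      haveI : Module.Finite ℤ_[2] (W.tateModule 2) := W.module_finite_tateModule_holds 2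
      ∀ (κ : ZpExtension ℚ 2) (γ : absoluteGaloisGroup ℚ) (hκ : κ.IsCyclotomic), κ.IsTopGenerator γ →
      ∀ (I : IwasawaH1Data W 2 κ γ) ⦃N : ℕ⦄ [NeZero N] (f : CuspForm (CongruenceSubgroup.Gamma0 N) 2),
        IsNewformOf W f →
      ∀ (ι : (m : ℕ) → (CyclotomicField m ℚ →+* ℂ)) (κ' : ℝ)
        (Λ' : ∀ (k : ℕ) (r : Finset (HeightOneSpectrum (𝓞 ℚ))),
          H1 (tateRep W 2) (cycSubgroup 2 k r) →ₗ[ℤ_[2]] ℚ_[2] ⊗[ℚ] CyclotomicField (cycLevel 2 k r) ℚ)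
        (c d a : ℤ) (A : ℕ)
        (z : ∀ (k : ℕ) (r : (cyclotomicLevelsRat 2 (badPlaces c d A N)).Ideals),
          H1 (tateRep W 2) ((cyclotomicLevelsRat 2 (badPlaces c d A N)).level k r.1))
        (x : ∀ (k : ℕ) (r : (cyclotomicLevelsRat 2 (badPlaces c d A N)).Ideals),
          CyclotomicField (cycLevel 2 k r.1) ℚ),
        ZetaBody W 2 f ι κ' Λ' c d a A z x →
      ∀ y : I.H, (∀ n : ℕ, I.proj n y = levelToLayerTwo W hκ (badPlaces c d A N) n
          (z (n + 2) (cyclotomicLevelsRat 2 (badPlaces c d A N)).idealOne)) →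
        y ≠ 0 ∧ (Finite (W.selmerGroupPInfty 2) → W.entireLFunction 1 = 0 → ∃ n : ℕ, 2 ^ n • I.proj 0 y = 0))
    (hMC : KatoMainConjectureAtTAtTwoNonCM) :
    ∀ (W : WeierstrassCurve ℚ) [W.IsElliptic] [W.IsGloballyMinimal],
      ¬ W.HasCM → W.selmerCorank 2 = 0 → W.analyticRank = 0 := by
  intro W _ _ hcm h0
  letI : ContinuousSMul ℤ_[2] (W.tateModule 2) := TateModule.continuousSMul_padicInt
  haveI : Module.Free ℤ_[2] (W.tateModule 2) := W.module_free_tateModule_holds 2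
  haveI : Module.Finite ℤ_[2] (W.tateModule 2) := W.module_finite_tateModule_holds 2
  obtain ⟨κ, hκ⟩ := ZpExtension.exists_isCyclotomic_holds ℚ 2
    (GaloisRep.cyclotomicCharacter_range_infinite ℚ 2)
  obtain ⟨γ, hγ⟩ := κ.surjective (Multiplicative.ofAdd 1)
  have hγ' : κ.IsTopGenerator γ := hγ
  obtain ⟨I⟩ := h1 W 2 κ γ hκ hγ'
  obtain ⟨hIf, ⟨hIt, hIr⟩, -⟩ := h12 W 2 κ γ hκ hγ' I
  obtain ⟨J⟩ := h2 W 2 κ γ hκ hγ' I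
  obtain ⟨N, hN, f, hf, ι, κ', Λ', c, d, a, A, z, x, hbodyW⟩ := hbody W hcm
  haveI := hN
  obtain ⟨y, hy, -⟩ := IwasawaH1Data.existsUnique_lift_of_zetaBody_two W hκ I f ι κ' Λ' c d a A z x hbodyW
  obtain ⟨hnz, hvan⟩ := hread W hcm κ γ hκ hγ' I f hf ι κ' Λ' c d a A z x hbodyW y hy
  exact analyticRank_eq_zero_of_katoMainConjectureAtT W hκ hγ' I hIf hIt hIr J f hf ι κ' Λ' c d a A z x
    hbodyW y hy hnz (fun hfin => h31 W 2 κ γ hκ hγ' I hfin) hvan (hMC W hcm) h0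

/-- **The same on the leaf's scope** (non-CM, good ordinary OR multiplicative at `2`) from the leaf-scoped object
`KatoMainConjectureAtTAtTwoOnLeaf`: the conjunction of the two rank-`0` cruxes of route S3 (19218, 19219) in
UNFOLDED form — `∀ W, ¬CM → (GoodOrd W 2 ∨ Mult W 2) → corank Sel_{2^∞} = 0 → r_an = 0`; the `Theses` leaf restates it
as `GoodOrdinaryRankZeroTwoConverse ∧ MultiplicativeRankZeroTwoConverse` by name.
[cite: BurungaleTian2026, Thm. 3.1 and Remark 3.2] [cite: Kato2004Asterisque, Conj. 12.10 (p. 224) and §14.14 (p. 243)] -/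
theorem onLeaf_rankZero_twoConverse_of_katoMainConjectureAtT
    (h1 : nonempty_iwasawaH1Data) (h2 : nonempty_iwasawaH2Data) (h12 : thm12_4)
    (h31 : finite_descentCokernel_of_finite_selmer)
    (hbody : ∀ (W : WeierstrassCurve ℚ) [W.IsElliptic] [W.IsGloballyMinimal], ¬ W.HasCM →
      letI : ContinuousSMul ℤ_[2] (W.tateModule 2) := TateModule.continuousSMul_padicInt
      haveI : Module.Free ℤ_[2] (W.tateModule 2) := W.module_free_tateModule_holds 2
      haveI : Module.Finite ℤ_[2] (W.tateModule 2) := W.module_finite_tateModule_holds 2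
      ∃ (N : ℕ) (_ : NeZero N) (f : CuspForm (CongruenceSubgroup.Gamma0 N) 2) (_ : IsNewformOf W f)
        (ι : (m : ℕ) → (CyclotomicField m ℚ →+* ℂ)) (κ' : ℝ)
        (Λ' : ∀ (k : ℕ) (r : Finset (HeightOneSpectrum (𝓞 ℚ))),
          H1 (tateRep W 2) (cycSubgroup 2 k r) →ₗ[ℤ_[2]] ℚ_[2] ⊗[ℚ] CyclotomicField (cycLevel 2 k r) ℚ)
        (c d a : ℤ) (A : ℕ)
        (z : ∀ (k : ℕ) (r : (cyclotomicLevelsRat 2 (badPlaces c d A N)).Ideals),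
          H1 (tateRep W 2) ((cyclotomicLevelsRat 2 (badPlaces c d A N)).level k r.1))
        (x : ∀ (k : ℕ) (r : (cyclotomicLevelsRat 2 (badPlaces c d A N)).Ideals),
          CyclotomicField (cycLevel 2 k r.1) ℚ),
        ZetaBody W 2 f ι κ' Λ' c d a A z x)
    (hread : ∀ (W : WeierstrassCurve ℚ) [W.IsElliptic] [W.IsGloballyMinimal], ¬ W.HasCM →
      letI : ContinuousSMul ℤ_[2] (W.tateModule 2) := TateModule.continuousSMul_padicInt
      haveI : Module.Free ℤ_[2] (W.tateModule 2) := W.module_free_tateModule_holds 2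
      haveI : Module.Finite ℤ_[2] (W.tateModule 2) := W.module_finite_tateModule_holds 2
      ∀ (κ : ZpExtension ℚ 2) (γ : absoluteGaloisGroup ℚ) (hκ : κ.IsCyclotomic), κ.IsTopGenerator γ →
      ∀ (I : IwasawaH1Data W 2 κ γ) ⦃N : ℕ⦄ [NeZero N] (f : CuspForm (CongruenceSubgroup.Gamma0 N) 2),
        IsNewformOf W f →
      ∀ (ι : (m : ℕ) → (CyclotomicField m ℚ →+* ℂ)) (κ' : ℝ)
        (Λ' : ∀ (k : ℕ) (r : Finset (HeightOneSpectrum (𝓞 ℚ))),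
          H1 (tateRep W 2) (cycSubgroup 2 k r) →ₗ[ℤ_[2]] ℚ_[2] ⊗[ℚ] CyclotomicField (cycLevel 2 k r) ℚ)
        (c d a : ℤ) (A : ℕ)
        (z : ∀ (k : ℕ) (r : (cyclotomicLevelsRat 2 (badPlaces c d A N)).Ideals),
          H1 (tateRep W 2) ((cyclotomicLevelsRat 2 (badPlaces c d A N)).level k r.1))
        (x : ∀ (k : ℕ) (r : (cyclotomicLevelsRat 2 (badPlaces c d A N)).Ideals),
          CyclotomicField (cycLevel 2 k r.1) ℚ),
        ZetaBody W 2 f ι κ' Λ' c d a A z x →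
      ∀ y : I.H, (∀ n : ℕ, I.proj n y = levelToLayerTwo W hκ (badPlaces c d A N) n
          (z (n + 2) (cyclotomicLevelsRat 2 (badPlaces c d A N)).idealOne)) →
        y ≠ 0 ∧ (Finite (W.selmerGroupPInfty 2) → W.entireLFunction 1 = 0 → ∃ n : ℕ, 2 ^ n • I.proj 0 y = 0))
    (hMC : KatoMainConjectureAtTAtTwoOnLeaf) :
    ∀ (W : WeierstrassCurve ℚ) [W.IsElliptic] [W.IsGloballyMinimal],
      ¬ W.HasCM → (GoodOrd W 2 ∨ Mult W 2) → W.selmerCorank 2 = 0 → W.analyticRank = 0 := by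
  intro W _ _ hcm hleaf h0
  letI : ContinuousSMul ℤ_[2] (W.tateModule 2) := TateModule.continuousSMul_padicInt
  haveI : Module.Free ℤ_[2] (W.tateModule 2) := W.module_free_tateModule_holds 2
  haveI : Module.Finite ℤ_[2] (W.tateModule 2) := W.module_finite_tateModule_holds 2
  obtain ⟨κ, hκ⟩ := ZpExtension.exists_isCyclotomic_holds ℚ 2
    (GaloisRep.cyclotomicCharacter_range_infinite ℚ 2)
  obtain ⟨γ, hγ⟩ := κ.surjective (Multiplicative.ofAdd 1)
  have hγ' : κ.IsTopGenerator γ := hγ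
  obtain ⟨I⟩ := h1 W 2 κ γ hκ hγ'
  obtain ⟨hIf, ⟨hIt, hIr⟩, -⟩ := h12 W 2 κ γ hκ hγ' I
  obtain ⟨J⟩ := h2 W 2 κ γ hκ hγ' I
  obtain ⟨N, hN, f, hf, ι, κ', Λ', c, d, a, A, z, x, hbodyW⟩ := hbody W hcm
  haveI := hN
  obtain ⟨y, hy, -⟩ := IwasawaH1Data.existsUnique_lift_of_zetaBody_two W hκ I f ι κ' Λ' c d a A z x hbodyW
  obtain ⟨hnz, hvan⟩ := hread W hcm κ γ hκ hγ' I f hf ι κ' Λ' c d a A z x hbodyW y hy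
  exact analyticRank_eq_zero_of_katoMainConjectureAtT W hκ hγ' I hIf hIt hIr J f hf ι κ' Λ' c d a A z x
    hbodyW y hy hnz (fun hfin => h31 W 2 κ γ hκ hγ' I hfin) hvan (hMC W hcm hleaf) h0

end Route

end Summit.BirchSwinnertonDyer.BirchSwinnertonDyer.Theorems.TwoAdicKatoZeta

end
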